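import Summits.BirchSwinnertonDyer.Rank2.MuCertificateAtTwo
import Literature.NumberTheory.EllipticCurves.IwasawaSelmerDualProofs
import Literature.Algebra.Module.CharacterModuleAnnihilator
import Literature.GroupTheory.FiniteAbelian.CharacterModuleUnitAddCircle
import Mathlib.Algebra.Polynomial.Module.AEval
import HarnessLib
import Summits.BirchSwinnertonDyer.Rank1Residual.X5.TwoAdicTargetsTowerGap

/-!
# The `μ`-certificate read on the Selmer group: `#(X/(p,T^m)X) ≤ #(Sel_{p^∞}(E/ℚ_∞)[p] ∩ ker (γ-1)^m)`

Planner p2 GEN 47 kernel, part 3 (cell bsd-rank2; HOME `run/shared/lean/pub/bsd-rank2/`, source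
`HOME/p2/g47/lean/MuCertificateAtTwoPontryagin.lean`; memo `HOME/p2/g47/TIGHT-ANCHOR.md`).  Sequel of
`Rank2/MuCertificateAtTwoCriterion` (§1) and `Rank2/MuCertificateAtTwo` (§2–§3, tree), which prove
`#(X/(p,T^m)X) < p^m ⟹ μ(X) = 0` for the Iwasawa module `X = X_p(E/ℚ_∞)` of a Selmer dual datum and feed it
into the GEN-43 `2`-adic rank-`2` dichotomy.  THIS file removes the auxiliary object `X` from the hypothesis:

* (a) algebra: `#(M^∨/I·M^∨) ≤ #M[I]` for `I = (a₁,…,aₙ)` with `M[I]` finite (`M^∨ = Hom(M, ℚ/ℤ)`; tree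
  `ker_dual_subtype_torsionBySet` = divisibility of `ℚ/ℤ`, `nonempty_characterModule_addEquiv`), and the
  transport of `(a,b)·M` along an additive bijection intertwining the generators (`map_pairSmulTop_eq`).
* (b) Selmer side: `Sel_∞ = Sel_{p^∞}(E/ℚ_∞)` as a `ℤ[X]`-module, `X ↦ T_γ = conj_γ - 1` (`Module.AEval'`);
  `toDual : X ≅ Hom(Sel_∞, ℚ/ℤ)` intertwines `PowerSeries.X^m ↦ X^m`, `C p ↦ C p` (`toDual_X_pow_smul`,
  `toDual_C_natCast_smul`), so `(p,T^m)·X ↦ (C p, X^m)·Hom(Sel_∞, ℚ/ℤ)` (`map_Psi_smul_top`) and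
  `#(X/(p,T^m)X) ≤ #(Sel_∞[p] ∩ ker T_γ^m)`, finite when the right side is
  (`SelmerDualCert.finite_and_natCard_quotient_le`).
Part 4 (`Rank2/MuCertificateAtTwoSelmerCert`) identifies the certificate group at `m = pⁿ` with
`(Sel_∞[p])^{Γ_n}` and concludes `#(Sel_∞[p])^{Γ_n} < p^{pⁿ} ⟹ μ = 0` and the dichotomy.
B1 HONESTY: algebra / Galois-cohomology bookkeeping only; no analytic rank; BSD is not proved.

## References
* R. Greenberg, LNM 1716 (1999), §1 (PDF p. 60: the `Λ`-module structure of `Sel_E(ℚ_∞)_p`). [GreenbergLNM1716]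
* L. C. Washington, *Introduction to Cyclotomic Fields*, GTM 83, §13.2. [Washington1997]
* J.-P. Serre, *A Course in Arithmetic*, VI §1.1 (duality of finite abelian groups). [Serre1973]
-/

set_option autoImplicit false

noncomputable section

open scoped Classical

open WeierstrassCurve Literature.NumberTheory.EllipticCurves
  Literature.NumberTheory.EllipticCurves.IwasawaAlgebra

namespace Summit.BirchSwinnertonDyer.Rank2

/-! ### §2b. Pontryagin duality: the certificate read on `Sel_{p^∞}(E/ℚ_∞)` itself

`X = Hom(Sel_{p^∞}(E/ℚ_∞), ℚ/ℤ)` (`SelmerDualData.toDual`, bijective, `T ↦ γ - 1`, `C c ↦ c`), so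
`X/(p, T^m)X = Hom(Sel[p] ∩ ker (γ-1)^m, ℚ/ℤ)`-sub (divisibility of `ℚ/ℤ`:
`Literature.Algebra.Module.ker_dual_subtype_torsionBySet`), whence
`#(X/(p,T^m)X) ≤ #(Sel_{p^∞}(E/ℚ_∞)[p] ∩ ker (γ-1)^m)`, and for `m = pⁿ` the right side is the finite-layer
group `(Sel_{p^∞}(E/ℚ_∞)[p])^{Γ_n}` (`(γ-1)^{pⁿ} ≡ γ^{pⁿ} - 1 (mod p)`).  The `ℤ[X]`-module structure
`X ↦ γ - 1` on `Sel_∞` is Mathlib's `Module.AEval'`. -/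

section PontryaginSide

open Polynomial

/-! #### (a) Pure algebra: `#(M^∨ / I·M^∨) ≤ #M[I]` for a finitely generated ideal with `M[I]` finite -/

section CharDual

variable {R : Type} [CommRing R] {M : Type} [AddCommGroup M] [Module R M]

/-- `#(M^∨ / I·M^∨) ≤ #M[I]` (`I = (a_1,…,a_n)`, `M[I]` finite): the restriction `M^∨ → (M[I])^∨`
kills exactly `I·M^∨` (`ker_dual_subtype_torsionBySet`) and `#(M[I])^∨ = #M[I]`. [folklore] -/
theorem natCard_quotient_smul_top_le_natCard_torsionBySet {n : ℕ} (a : Fin n → R)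
    [Finite (Submodule.torsionBySet R M (Set.range a))] :
    Finite (CharacterModule M ⧸ Ideal.span (Set.range a) • (⊤ : Submodule R (CharacterModule M))) ∧
    Nat.card (CharacterModule M ⧸ Ideal.span (Set.range a) • (⊤ : Submodule R (CharacterModule M))) ≤
      Nat.card (Submodule.torsionBySet R M (Set.range a)) := by
  set f := CharacterModule.dual (R := R) (Submodule.torsionBySet R M (Set.range a)).subtype with hf
  set fbar := (LinearMap.ker f).liftQ f le_rfl with hfbar
  have hinj : Function.Injective fbar := by
    rw [← LinearMap.ker_eq_bot, hfbar]
    exact Submodule.ker_liftQ_eq_bot _ _ _ le_rfl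
  rw [← Literature.Algebra.Module.ker_dual_subtype_torsionBySet a]
  obtain ⟨e⟩ := Literature.GroupTheory.FiniteAbelian.nonempty_characterModule_addEquiv
    (Submodule.torsionBySet R M (Set.range a))
  haveI : Finite (CharacterModule (Submodule.torsionBySet R M (Set.range a))) :=
    Finite.of_equiv _ e.toEquiv.symm
  exact ⟨Finite.of_injective fbar hinj,
    (Nat.card_le_card_of_injective fbar hinj).trans (Nat.card_congr e.toEquiv).le⟩

/-- Membership of the two generators in `{a, b}`. -/
theorem mem_pair_left {α : Type*} (a b : α) : a ∈ ({a, b} : Set α) := Set.mem_insert _ _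
/-- Membership of the second generator in `{a, b}`. -/
theorem mem_pair_right {α : Type*} (a b : α) : b ∈ ({a, b} : Set α) :=
  Set.mem_insert_of_mem _ (Set.mem_singleton _)

/-- Transport of `(a, b)·M` along an additive map intertwining `a ↦ a'`, `b ↦ b'`. [folklore] -/
theorem map_pairSmulTop_le {R' M' : Type} [CommRing R'] [AddCommGroup M'] [Module R' M']
    (Ψ : M →+ M') {a b : R} {a' b' : R'} (ha : ∀ x, Ψ (a • x) = a' • Ψ x)
    (hb : ∀ x, Ψ (b • x) = b' • Ψ x) :
    ((Ideal.span {a, b} • (⊤ : Submodule R M)).toAddSubgroup).map Ψ ≤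
      (Ideal.span {a', b'} • (⊤ : Submodule R' M')).toAddSubgroup := by
  intro ψ hψ'
  obtain ⟨x, hx, rfl⟩ := AddSubgroup.mem_map.mp hψ'
  rw [Submodule.mem_toAddSubgroup] at hx
  rw [Submodule.mem_toAddSubgroup]
  refine Submodule.smul_induction_on hx ?_ ?_
  · intro r hr y _
    rw [Ideal.mem_span_pair] at hr
    obtain ⟨u, v, rfl⟩ := hr
    rw [add_smul, mul_comm u a, mul_comm v b, mul_smul, mul_smul, map_add, ha, hb]
    exact Submodule.add_mem _
      (Submodule.smul_mem_smul (Ideal.subset_span (mem_pair_left _ _)) Submodule.mem_top)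
      (Submodule.smul_mem_smul (Ideal.subset_span (mem_pair_right _ _)) Submodule.mem_top)
  · intro x y hx hy
    rw [map_add]
    exact Submodule.add_mem _ hx hy

/-- With `Ψ` surjective the transport is onto. [folklore] -/
theorem map_pairSmulTop_eq {R' M' : Type} [CommRing R'] [AddCommGroup M'] [Module R' M']
    (Ψ : M →+ M') {a b : R} {a' b' : R'} (ha : ∀ x, Ψ (a • x) = a' • Ψ x)
    (hb : ∀ x, Ψ (b • x) = b' • Ψ x) (hΨ : Function.Surjective Ψ) :
    ((Ideal.span {a, b} • (⊤ : Submodule R M)).toAddSubgroup).map Ψ =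
      (Ideal.span {a', b'} • (⊤ : Submodule R' M')).toAddSubgroup := by
  refine le_antisymm (map_pairSmulTop_le Ψ ha hb) ?_
  intro ψ hψ
  rw [Submodule.mem_toAddSubgroup] at hψ
  refine Submodule.smul_induction_on hψ ?_ ?_
  · intro r hr χ _
    rw [Ideal.mem_span_pair] at hr
    obtain ⟨u, v, rfl⟩ := hr
    obtain ⟨y₁, hy₁⟩ := hΨ (u • χ)
    obtain ⟨y₂, hy₂⟩ := hΨ (v • χ)
    have e : (u * a' + v * b') • χ = Ψ (a • y₁ + b • y₂) := by
      rw [map_add, ha, hb, hy₁, hy₂, add_smul, mul_comm u, mul_comm v, mul_smul, mul_smul]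
    rw [e]
    exact AddSubgroup.mem_map_of_mem _ (show _ ∈ (Submodule.toAddSubgroup _) from
      Submodule.add_mem _
        (Submodule.smul_mem_smul (Ideal.subset_span (mem_pair_left _ _)) Submodule.mem_top)
        (Submodule.smul_mem_smul (Ideal.subset_span (mem_pair_right _ _)) Submodule.mem_top))
  · intro x y hx hy
    exact AddSubgroup.add_mem _ hx hy

end CharDual

/-! #### (b) The Selmer side: `#(X/(p,T^m)X) ≤ #(Sel_{p^∞}(E/ℚ_∞)[p] ∩ ker (γ-1)^m)` -/

section SelmerSide

open WeierstrassCurve Literature.NumberTheory.EllipticCurves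

variable {p : ℕ} [Fact p.Prime] (W : WeierstrassCurve ℚ) (κ : ZpExtension ℚ p)
  (γ : Field.absoluteGaloisGroup ℚ)

/-- `T_γ = conj_γ - 1` acting on `Sel_{p^∞}(E/ℚ_∞)` (`conjSelmerInfty`). Greenberg (1999), §1. -/
def selT : AddMonoid.End (W.selmerInfty κ) :=
  W.conjSelmerInfty κ γ - 1

/-- The **certificate group** `Sel_{p^∞}(E/ℚ_∞)[p] ∩ ker T_γ^m`: the classes killed by `p` and by
`(γ - 1)^m`.  For `m = pⁿ` one has `T^{pⁿ} ≡ ω_n = γ^{pⁿ} - 1 (mod p)`, so this is the group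
`(Sel_{p^∞}(E/ℚ_∞)[p])[ω_n]` of layer-`n` size. -/
def selmerCert (m : ℕ) : AddSubgroup (W.selmerInfty κ) :=
  (DistribSMul.toAddMonoidHom (W.selmerInfty κ) p).ker ⊓
    (((selT W κ γ) ^ m : AddMonoid.End (W.selmerInfty κ)) : W.selmerInfty κ →+ W.selmerInfty κ).ker

/-- Unfolding lemma: `s ∈ selmerCert m ↔ p•s = 0 ∧ T_γ^m s = 0`. -/
theorem mem_selmerCert {m : ℕ} {s : W.selmerInfty κ} :
    s ∈ selmerCert W κ γ m ↔ p • s = 0 ∧ ((selT W κ γ) ^ m) s = 0 :=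
  Iff.rfl

/-- `T_γ` as a `ℤ`-linear endomorphism (to feed `Module.AEval'`). -/
def selTLin : (W.selmerInfty κ) →ₗ[ℤ] (W.selmerInfty κ) :=
  (selT W κ γ : W.selmerInfty κ →+ W.selmerInfty κ).toIntLinearMap

/-- Powers of the `ℤ`-linear `T_γ` agree with powers of the additive `T_γ`. -/
theorem selTLin_pow_apply (m : ℕ) (s : W.selmerInfty κ) :
    ((selTLin W κ γ) ^ m) s = ((selT W κ γ) ^ m) s := by
  induction m generalizing s with
  | zero => rfl
  | succ m ih =>
    rw [pow_succ, pow_succ, Module.End.mul_apply, AddMonoid.End.coe_mul, Function.comp_apply]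
    exact ih _

/-- In the `ℤ[X]`-module `Module.AEval' (selTLin W κ γ)` (`Sel_∞` with `X ↦ T_γ`),
`of⁻¹ (X^m • a) = T_γ^m (of⁻¹ a)`. -/
theorem of_symm_X_pow_smul (m : ℕ) (a : Module.AEval' (selTLin W κ γ)) :
    (Module.AEval'.of (selTLin W κ γ)).symm ((X : ℤ[X]) ^ m • a) =
      ((selT W κ γ) ^ m) ((Module.AEval'.of (selTLin W κ γ)).symm a) := by
  obtain ⟨s, rfl⟩ := (Module.AEval'.of (selTLin W κ γ)).surjective a
  rw [Module.AEval'.X_pow_smul_of, LinearEquiv.symm_apply_apply, LinearEquiv.symm_apply_apply,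
    Module.End.smul_def, selTLin_pow_apply]

/-- `of⁻¹ (C n • a) = n • of⁻¹ a`. -/
theorem of_symm_C_smul (n : ℤ) (a : Module.AEval' (selTLin W κ γ)) :
    (Module.AEval'.of (selTLin W κ γ)).symm ((Polynomial.C n) • a) =
      n • ((Module.AEval'.of (selTLin W κ γ)).symm a) := by
  rw [Module.AEval.C_smul]
  exact map_smul ((Module.AEval'.of (selTLin W κ γ)).symm) n a

variable {W κ γ}

namespace SelmerDualCert

variable (D : W.SelmerDualData κ γ)

/-- `(X^m • x)(s) = x(T_γ^m s)`. -/
theorem toDual_X_pow_smul (m : ℕ) (x : D.X) (s : W.selmerInfty κ) :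
    D.toDual ((PowerSeries.X : IwasawaAlgebra p) ^ m • x) s = D.toDual x (((selT W κ γ) ^ m) s) := by
  induction m generalizing s with
  | zero => rw [pow_zero, one_smul, pow_zero, AddMonoid.End.coe_one, id_eq]
  | succ m ih =>
    rw [pow_succ', mul_smul, D.toDual_T_smul, ih, ih, ← map_sub, ← map_sub, pow_succ,
      AddMonoid.End.coe_mul, Function.comp_apply]
    congr 2

/-- `(C p • x)(s) = x(p • s)` (constants act through `ℤ_p → ℤ/p^k` on the `p^k`-torsion class `s`). -/
theorem toDual_C_natCast_smul (x : D.X) (s : W.selmerInfty κ) :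
    D.toDual (PowerSeries.C (p : ℤ_[p]) • x) s = D.toDual x (p • s) := by
  obtain ⟨k, hk⟩ := W.exists_pow_smul_subgroupH1_ker_eq_zero κ (s : W.subgroupH1 p κ.kerSubgroup)
  have hk' : p ^ k • s = 0 := Subtype.ext (by rw [AddSubgroupClass.coe_nsmul]; exact hk)
  have hk2 : p ^ (k + 2) • s = 0 := by
    rw [pow_add, mul_comm, mul_smul, hk', smul_zero]
  rw [D.toDual_C_smul (p : ℤ_[p]) x s (k + 2) hk2, map_natCast, ZMod.val_natCast,
    Nat.mod_eq_of_lt, map_nsmul]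
  calc p = p ^ 1 := (pow_one p).symm
    _ < p ^ (k + 2) := Nat.pow_lt_pow_right (Fact.out : p.Prime).one_lt (by omega)

/-- The transport `Ψ : X → Hom(Sel_∞^{(X ↦ T_γ)}, ℚ/ℤ)`, `x ↦ toDual x ∘ of⁻¹`. -/
def Psi : D.X →+ CharacterModule (Module.AEval' (selTLin W κ γ)) where
  toFun x := (D.toDual x).comp (Module.AEval'.of (selTLin W κ γ)).symm.toLinearMap.toAddMonoidHom
  map_zero' := by
    ext a
    show D.toDual 0 _ = 0
    rw [map_zero]
    rfl
  map_add' x y := by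
    ext a
    show D.toDual (x + y) _ = D.toDual x _ + D.toDual y _
    rw [map_add]
    rfl

/-- Unfolding lemma for `Ψ`. -/
theorem Psi_apply (x : D.X) (a : Module.AEval' (selTLin W κ γ)) :
    Psi D x a = D.toDual x ((Module.AEval'.of (selTLin W κ γ)).symm a) :=
  rfl

/-- `Ψ` is bijective (transport of the Pontryagin-duality bijection of `D`). -/
theorem Psi_bijective : Function.Bijective (Psi D) := by
  constructor
  · intro x y h
    apply D.bijective.1
    ext s
    have := congrArg (fun χ => χ (Module.AEval'.of (selTLin W κ γ) s)) h
    simpa only [Psi_apply, LinearEquiv.symm_apply_apply] using this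
  · intro χ
    obtain ⟨x, hx⟩ := D.bijective.2
      (χ.comp (Module.AEval'.of (selTLin W κ γ)).toLinearMap.toAddMonoidHom)
    refine ⟨x, ?_⟩
    ext a
    rw [Psi_apply, hx]
    change χ ((Module.AEval'.of (selTLin W κ γ)) ((Module.AEval'.of (selTLin W κ γ)).symm a)) = χ a
    rw [LinearEquiv.apply_symm_apply]

/-- `Ψ` intertwines `T^m` on `X` with `X^m` on the character module. -/
theorem Psi_X_pow_smul (m : ℕ) (x : D.X) :
    Psi D ((PowerSeries.X : IwasawaAlgebra p) ^ m • x) = (X : ℤ[X]) ^ m • Psi D x := by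
  ext a
  rw [Psi_apply, toDual_X_pow_smul, CharacterModule.smul_apply, Psi_apply, of_symm_X_pow_smul]

/-- `Ψ` intertwines `C p` on `X` with `C p` on the character module. -/
theorem Psi_C_smul (x : D.X) :
    Psi D (PowerSeries.C (p : ℤ_[p]) • x) = (Polynomial.C (p : ℤ)) • Psi D x := by
  ext a
  rw [Psi_apply, toDual_C_natCast_smul, CharacterModule.smul_apply, Psi_apply, of_symm_C_smul,
    natCast_zsmul]

/-! #### The image of `(p, T^m)·X` under `Ψ` is `(C p, X^m)·Hom(Sel, ℚ/ℤ)` -/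

/-- The image of `(p, T^m)·X` under `Ψ` is `(C p, X^m)·Hom(Sel, ℚ/ℤ)`. -/
theorem map_Psi_smul_top (m : ℕ) :
    ((Ideal.span {PowerSeries.C (p : ℤ_[p]), (PowerSeries.X : IwasawaAlgebra p) ^ m} •
        (⊤ : Submodule (IwasawaAlgebra p) D.X)).toAddSubgroup).map (Psi D) =
      ((Ideal.span {Polynomial.C (p : ℤ), (X : ℤ[X]) ^ m}) •
        (⊤ : Submodule ℤ[X] (CharacterModule (Module.AEval' (selTLin W κ γ))))).toAddSubgroup :=
  map_pairSmulTop_eq (Psi D) (Psi_C_smul D) (Psi_X_pow_smul D m) (Psi_bijective D).2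

/-- `#(X/(p,T^m)X) = #(Hom(Sel,ℚ/ℤ)/(C p, X^m))` (transport along the bijection `Ψ`). -/
theorem natCard_quotient_eq (m : ℕ) :
    Nat.card (D.X ⧸ (Ideal.span {PowerSeries.C (p : ℤ_[p]), (PowerSeries.X : IwasawaAlgebra p) ^ m} •
        (⊤ : Submodule (IwasawaAlgebra p) D.X))) =
      Nat.card (CharacterModule (Module.AEval' (selTLin W κ γ)) ⧸
        ((Ideal.span {Polynomial.C (p : ℤ), (X : ℤ[X]) ^ m}) •
          (⊤ : Submodule ℤ[X] (CharacterModule (Module.AEval' (selTLin W κ γ)))))) := by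
  rw [Summit.BirchSwinnertonDyer.Rank1Residual.X5.TowerGap.natCard_quotient_eq_index,
    Summit.BirchSwinnertonDyer.Rank1Residual.X5.TowerGap.natCard_quotient_eq_index, ← map_Psi_smul_top,
    AddSubgroup.index_map_of_bijective (Psi_bijective D)]

omit [Fact p.Prime] in
/-- The range of the vector `![C p, X^m]` is the pair `{C p, X^m}`. -/
theorem range_vec2 (m : ℕ) :
    Set.range ![Polynomial.C (p : ℤ), (X : ℤ[X]) ^ m] = {Polynomial.C (p : ℤ), (X : ℤ[X]) ^ m} := by
  rw [Matrix.range_cons, Matrix.range_cons, Matrix.range_empty, Set.union_empty, Set.singleton_union]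

/-- `(Sel^{(X ↦ T_γ)})[C p, X^m] ≃ Sel[p] ∩ ker T_γ^m`. -/
theorem mem_torsionBySet_iff (m : ℕ) (t : Module.AEval' (selTLin W κ γ)) :
    t ∈ Submodule.torsionBySet ℤ[X] (Module.AEval' (selTLin W κ γ))
        (Set.range ![Polynomial.C (p : ℤ), (X : ℤ[X]) ^ m]) ↔
      (Module.AEval'.of (selTLin W κ γ)).symm t ∈ selmerCert W κ γ m := by
  rw [Submodule.mem_torsionBySet_iff, mem_selmerCert, Subtype.forall, range_vec2]
  simp only [Set.mem_insert_iff, Set.mem_singleton_iff, forall_eq_or_imp, forall_eq]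
  rw [← (Module.AEval'.of (selTLin W κ γ)).symm.map_eq_zero_iff (x := Polynomial.C (p : ℤ) • t),
    ← (Module.AEval'.of (selTLin W κ γ)).symm.map_eq_zero_iff (x := (X : ℤ[X]) ^ m • t),
    of_symm_C_smul, natCast_zsmul, of_symm_X_pow_smul]

/-- The bijection `Sel[p] ∩ ker T_γ^m ≃ (Sel^{(X ↦ T_γ)})[C p, X^m]`. -/
def certEquiv (m : ℕ) :
    selmerCert W κ γ m ≃ Submodule.torsionBySet ℤ[X] (Module.AEval' (selTLin W κ γ))
        (Set.range ![Polynomial.C (p : ℤ), (X : ℤ[X]) ^ m]) where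
  toFun s := ⟨Module.AEval'.of (selTLin W κ γ) s.1,
    (mem_torsionBySet_iff m _).mpr (by rw [LinearEquiv.symm_apply_apply]; exact s.2)⟩
  invFun t := ⟨(Module.AEval'.of (selTLin W κ γ)).symm t.1, (mem_torsionBySet_iff m _).mp t.2⟩
  left_inv s := Subtype.ext (LinearEquiv.symm_apply_apply _ _)
  right_inv t := Subtype.ext (LinearEquiv.apply_symm_apply _ _)

/-- **`#(X/(p,T^m)X) ≤ #(Sel_{p^∞}(E/ℚ_∞)[p] ∩ ker T_γ^m)`**, and the left side is finite when the right
side is: Pontryagin duality `X = Hom(Sel, ℚ/ℤ)` carries `(p,T^m)·X` onto the characters vanishing on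
`Sel[p] ∩ ker T_γ^m` (divisibility of `ℚ/ℤ`), so `X/(p,T^m)X ↪ Hom(Sel[p] ∩ ker T_γ^m, ℚ/ℤ)`.
Greenberg (1999), §1 (PDF p. 60); Washington, §13.2. [folklore] -/
theorem finite_and_natCard_quotient_le (m : ℕ) [Finite (selmerCert W κ γ m)] :
    Finite (D.X ⧸ (Ideal.span {PowerSeries.C (p : ℤ_[p]), (PowerSeries.X : IwasawaAlgebra p) ^ m} •
        (⊤ : Submodule (IwasawaAlgebra p) D.X))) ∧
    Nat.card (D.X ⧸ (Ideal.span {PowerSeries.C (p : ℤ_[p]), (PowerSeries.X : IwasawaAlgebra p) ^ m} •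
        (⊤ : Submodule (IwasawaAlgebra p) D.X))) ≤ Nat.card (selmerCert W κ γ m) := by
  haveI : Finite (Submodule.torsionBySet ℤ[X] (Module.AEval' (selTLin W κ γ))
      (Set.range ![Polynomial.C (p : ℤ), (X : ℤ[X]) ^ m])) := Finite.of_equiv _ (certEquiv m)
  obtain ⟨hfin, hle⟩ := natCard_quotient_smul_top_le_natCard_torsionBySet
    (M := Module.AEval' (selTLin W κ γ)) ![Polynomial.C (p : ℤ), (X : ℤ[X]) ^ m]
  rw [range_vec2] at hfin hle
  have hcard := natCard_quotient_eq D m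
  refine ⟨Nat.finite_of_card_ne_zero (by rw [hcard]; exact Nat.card_pos.ne'), ?_⟩
  rw [hcard]
  have hc := Nat.card_congr (certEquiv (W := W) (κ := κ) (γ := γ) m)
  rw [range_vec2] at hc
  exact hle.trans hc.symm.le

end SelmerDualCert

end SelmerSide

end PontryaginSide

end Summit.BirchSwinnertonDyer.Rank2
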